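/-
Copyright (c) 2026 the pub-hodgecm-mathlib formalisation cell (harness21).  Prover seat hodgecm-mathlib-K2E1-p14 (g4), Track B ∕ K2-LIT, h413 = `stmt-HodgeConjecture-24833`,
R90-TF section S8 «ContSpec-n½», (M) socket road ∕ (R)′ `hDISC` = ★ `hDISC_of_kFinite_translation (hW1) (hTRANS)` (R90-C133-p02 (g2) p864277): the (T_f) half of `hTRANS`
re-expands a right finite-adelic translate `r(g_f) flat(φ, z)` as `Σ_j c_j^z · flat(ψ_j, z)` along the level sets of the HEIGHT COCYCLE `x ↦ H(x·g_f)∕H(x)`; this file is the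
S–M input «the cocycle is left-`B(𝔸)`-invariant, locally constant, with finitely many values» (S8 dealer R90-CS-plan (g3) S8-R213 (a); census
`K2/K2E1-p14/g4/CENSUS-E7-HeightCocycleFiniteValues.K2E1-p14-g4.md`; consumer census `R90/S8/CENSUS-hTRANS-payer.R90-C133-p02-g2.md` item 2).
-/
import Literature.NumberTheory.Automorphic.UnitaryGroupBorelHeightContinuous    -- ★ `isLocallyConstant_finprod_vecFinHeight_lastRow`, `vecHeight_lastRow_pos` (Garrett §2.2 ∕ MW95 I.2.2)
import Literature.NumberTheory.Automorphic.UnitaryGroupIwasawaAdelic             -- ★ `exists_mem_borelAdelic_mul_mem_standardMaximalCompactGL_cm_three` (adelic Iwasawa, CM `N = 3`)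
import Literature.NumberTheory.Automorphic.UnitaryGroupTorusSiegelIntegral      -- ★ `borelHeight_pos` (`0 < H`)
import Literature.NumberTheory.Automorphic.UnitaryGroupIwasawaIntegration        -- ★ `isCompact_comap_adelicVal_standardMaximalCompactGL` (`K_U = G(𝔸) ∩ K_∞·GL_N(𝒪̂)` compact)
import HarnessLib

/-!
# S8 (M)-road input — `R90S8HeightCocycleFiniteValuesU3`: THE HEIGHT COCYCLE `c_g(x) = H(x·ι_f g)∕H(x)` OF A FINITE-ADELIC TRANSLATION IS LEFT-`B(𝔸)`-INVARIANT, LOCALLY CONSTANT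
# ON `U(J_N)(𝔸_F)`, AND TAKES FINITELY MANY VALUES (letter-free at CM `N = 3`)

Track B ∕ K2-LIT, crux h413 = `stmt-HodgeConjecture-24833`, route of record `HCCMUnconditional`; cell `hodgecm-mathlib`, R90-TF programme, section S8 «ContSpec-n½», the (M) socket
road: (R)′'s discreteness letter `hDISC` is ★ `hDISC_of_kFinite_translation (hW1) (hTRANS)` (p864277), and the finite-adelic half (T_f) of `hTRANS` («right translates of residue classes of
`K`-finite level-⊥ sections stay in `A_⊥`») is paid POINTWISE by re-expanding `x ↦ flat(φ, z)(x·g_f) = (H(x g_f)∕H(x))^z · …` along the level sets of the height cocycle — which needs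
exactly: the cocycle is left-`B(𝔸_F)`-invariant, each level set is CLOPEN, and there are FINITELY many values.  THEOREMS ONLY (no `def`, no `instance`, no `notation`, no named-fact
hypothesis, no `sorry`; default heartbeats); lane `--supports stmt-HodgeConjecture-24833 --as helper` (count-neutral).  CLOSES NO SOCKET.

THE ARGUMENT (Garrett 2018 §2.2; Mœglin–Waldspurger I.2.2), with NO local `q_v^ℤ` analysis and NO coset count.  `H(x) = h(e_N x)⁻¹` with `h = (∏_{w∣∞} ‖·‖_w^{mult w}) · FP`,
`FP(x) := ∏ᶠ_v h_v(e_N x)` (★ `vecHeight`, `borelHeight_def`).  (§1) Right multiplication by `ι_f g = (1, g)` does not move the archimedean coordinates of the last row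
(`(e_N (x·ι_f g))_∞ = (e_N x)_∞ · 1`, ★ `lastRow_mul` + ★ `GLn.coe_ofFinite_apply`), so the archimedean factor cancels and **`c_g(x) = FP(x) ∕ FP(x·ι_f g)`**.  (§2) ★
`isLocallyConstant_finprod_vecFinHeight_lastRow`: `FP` is locally constant on `G(𝔸)` (constant on the cosets of the open subgroup `{u : u_f ∈ GL_N(𝒪̂_E)}`), hence so is `c_g`, and every
fibre `{x | c_g x = r}` is clopen.  (§3) `H(b y) = ‖b_NN‖⁻¹ H(y)` (★ `borelHeight_borel_mul`) twice: `c_g(b x) = c_g(x)`.  (§4) By the adelic Iwasawa decomposition `G(𝔸) = B(𝔸)·K_U`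
(★ `exists_mem_borelAdelic_mul_mem_standardMaximalCompactGL_cm_three` at CM `N = 3`; a letter in general) the range of `c_g` is its image of the COMPACT `K_U` (★
`isCompact_comap_adelicVal_standardMaximalCompactGL`), and a locally constant function has finite range on a compact space.
* §1 `fst_lastRow_mul_finAdelicToAdelic`, `vecArchNorm_lastRow_mul_finAdelicToAdelic`, **`borelHeight_mul_finAdelicToAdelic_div_eq`** (`c_g = FP ∕ FP(·ι_f g)`).
* §2 **`isLocallyConstant_borelHeight_mul_finAdelicToAdelic_div`**, **`isClopen_setOf_borelHeight_mul_finAdelicToAdelic_div_eq`** (every fibre clopen, all `r : ℝ≥0`, all of `G(𝔸)`),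
  `continuous_borelHeight_mul_finAdelicToAdelic_div`.
* §3 **`borelHeight_borel_mul_mul_finAdelicToAdelic_div`** (left-`B(𝔸_F)`-invariance).
* §4 **`finite_range_borelHeight_mul_finAdelicToAdelic_div_of_iwasawa`** (generic `(F, E, c, N)` modulo the Iwasawa letter), **`finite_range_borelHeight_mul_finAdelicToAdelic_div_cm_three`**,
  **`exists_finset_borelHeight_mul_finAdelicToAdelic_div_mem_cm_three`** (`∃ s : Finset ℝ≥0, ∀ x, c_g x ∈ s`, letter-free at CM `N = 3`).
HONEST LABEL: HC_CM is proved only modulo the 7 printed citations (2 remaining named inputs: hLiu418 = `stmt-HodgeConjecture-24832`, h413 = `stmt-HodgeConjecture-24833`) until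
rung 0 closes; REL ≠ ★ ≠ BUILT; this file asserts no named fact and closes no socket; count-neutral; unconditional.

## References
* [Garrett2018] P. Garrett, *Modern Analysis of Automorphic Forms by Example* (CUP 2018), §2.2 (PDF pp. 81–83): local heights, `h_v` right-`K_v`-invariant, `= 1` for almost all `v`.
* [MoeglinWaldspurger1995] C. Mœglin, J.-L. Waldspurger, *Spectral Decomposition and Eisenstein Series* (CUP 1995), I.2.2 (heights `m_P`, continuity), II.1 (Eisenstein series and translation).
* [BorelJacquet1979] A. Borel, H. Jacquet, *Automorphic forms and automorphic representations*, Proc. Symp. Pure Math. 33.1 (1979), §4.1 (`G(𝔸) = G_∞ × G(𝔸_f)`).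
-/

set_option autoImplicit false
set_option linter.dupNamespace false  -- the mandated namespace `…HodgeConjecture.HodgeConjecture.R90.S8` (LEAD #1 L1) repeats the summit's segment

noncomputable section

open Topology NumberField Set Matrix
open scoped NNReal
open Literature.NumberTheory.Automorphic Literature.NumberTheory.Automorphic.UnitaryGroup AdelicGroupData

namespace Summit.HodgeConjecture.HodgeConjecture.R90.S8

section Generic

variable {F E : Type} [Field F] [NumberField F] [Field E] [NumberField E] [Algebra F E] {c : E ≃ₐ[F] E} {N : ℕ} [NeZero N]

/-! ## §1 The archimedean factor cancels: `c_g(x) = FP(x) ∕ FP(x·ι_f g)` -/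

/-- **Right multiplication by `ι_f g = (1, g)` does not move the archimedean coordinates of the last row**: `(e_N (x·ι_f g))_i,∞ = (e_N x)_i,∞` (`e_N (x y) = (e_N x)·y`, ★ `lastRow_mul`,
and the archimedean part of the matrix `(1, g)` is `1`, ★ `GLn.coe_ofFinite_apply`). [cite: BorelJacquet1979, §4.1] [cite: Garrett2018, §2.2 (PDF p. 83)] -/
theorem fst_lastRow_mul_finAdelicToAdelic (x : (quasiSplit F E c N).Adelic) (g : ↥(finAdelic F E c N ((StdForm.antidiagonal N).over E))) (i : Fin N) :
    (lastRow (x * finAdelicToAdelic F E c N ((StdForm.antidiagonal N).over E) g) i).1 = (lastRow x i).1 := by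
  classical
  rw [lastRow_mul, adelicVal_finAdelicToAdelic]
  -- push the archimedean projection (the ring hom `adeleFst`) through the sum and the products
  have key : ∀ f : Fin N → AdeleRing (𝓞 E) E, (∑ j, f j).1 = ∑ j, (f j).1 := fun f => map_sum (adeleFst E) f Finset.univ
  have key2 : ∀ a b : AdeleRing (𝓞 E) E, (a * b).1 = a.1 * b.1 := fun _ _ => rfl
  simp only [Matrix.vecMul, dotProduct, key, key2, GLn.coe_ofFinite_apply]
  simp only [Matrix.one_apply, mul_ite, mul_one, mul_zero, Finset.sum_ite_eq', Finset.mem_univ, if_true]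

/-- Hence **the archimedean local norms of the last row are unchanged**: `‖e_N (x·ι_f g)‖_w = ‖e_N x‖_w` for every `w ∣ ∞`. [cite: Garrett2018, §2.2 (PDF p. 81)] -/
theorem vecArchNorm_lastRow_mul_finAdelicToAdelic (w : InfinitePlace E) (x : (quasiSplit F E c N).Adelic)
    (g : ↥(finAdelic F E c N ((StdForm.antidiagonal N).over E))) :
    vecArchNorm E w (lastRow (x * finAdelicToAdelic F E c N ((StdForm.antidiagonal N).over E) g)) = vecArchNorm E w (lastRow x) := by
  unfold vecArchNorm
  simp_rw [fst_lastRow_mul_finAdelicToAdelic]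

/-- **THE COCYCLE FORMULA `H(x·ι_f g)∕H(x) = FP(x) ∕ FP(x·ι_f g)`**, `FP(y) = ∏ᶠ_v h_v(e_N y)` the finite part of the height: the archimedean factor `∏_w ‖e_N ·‖_w^{mult w}` is the same
for `x` and `x·ι_f g` (`vecArchNorm_lastRow_mul_finAdelicToAdelic`) and cancels (it is non-zero by ★ `vecHeight_lastRow_pos`). [cite: Garrett2018, §2.2 (PDF p. 82)] -/
theorem borelHeight_mul_finAdelicToAdelic_div_eq (x : (quasiSplit F E c N).Adelic) (g : ↥(finAdelic F E c N ((StdForm.antidiagonal N).over E))) :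
    borelHeight (x * finAdelicToAdelic F E c N ((StdForm.antidiagonal N).over E) g) / borelHeight x =
      (∏ᶠ v, vecFinHeight E v (lastRow x)) / ∏ᶠ v, vecFinHeight E v (lastRow (x * finAdelicToAdelic F E c N ((StdForm.antidiagonal N).over E) g)) := by
  -- abbreviations: `A` the archimedean factor (common to `x` and `x ι_f g`), `P`, `P'` the finite parts
  set y := x * finAdelicToAdelic F E c N ((StdForm.antidiagonal N).over E) g with hy
  have hA : (∏ w : InfinitePlace E, vecArchNorm E w (lastRow y) ^ w.mult) = ∏ w : InfinitePlace E, vecArchNorm E w (lastRow x) ^ w.mult :=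
    Finset.prod_congr rfl fun w _ => by rw [hy, vecArchNorm_lastRow_mul_finAdelicToAdelic]
  have hx : vecHeight E (lastRow x) = (∏ w : InfinitePlace E, vecArchNorm E w (lastRow x) ^ w.mult) * ∏ᶠ v, vecFinHeight E v (lastRow x) := rfl
  have hyx : vecHeight E (lastRow y) = (∏ w : InfinitePlace E, vecArchNorm E w (lastRow x) ^ w.mult) * ∏ᶠ v, vecFinHeight E v (lastRow y) := by
    rw [← hA]; rfl
  have hA0 : (∏ w : InfinitePlace E, vecArchNorm E w (lastRow x) ^ w.mult) ≠ 0 := by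
    intro h0
    have hpos := vecHeight_lastRow_pos x
    rw [hx, h0, zero_mul] at hpos
    exact lt_irrefl _ hpos
  rw [borelHeight_def, borelHeight_def, hyx, hx, div_eq_mul_inv, inv_inv, mul_comm, ← div_eq_mul_inv, mul_div_mul_left _ _ hA0]

/-! ## §2 Local constancy and clopen level sets -/

/-- **THE HEIGHT COCYCLE IS LOCALLY CONSTANT ON `U(J_N)(𝔸_F)`**: by §1 it is the quotient of the finite parts `FP(x) ∕ FP(x·ι_f g)`, and `FP` is locally constant (★
`isLocallyConstant_finprod_vecFinHeight_lastRow`: constant on the cosets of the open subgroup `{u : u_f ∈ GL_N(𝒪̂_E)}`), as is `FP ∘ (· * ι_f g)`. [cite: Garrett2018, §2.2 (PDF p. 82)] -/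
theorem isLocallyConstant_borelHeight_mul_finAdelicToAdelic_div (g : ↥(finAdelic F E c N ((StdForm.antidiagonal N).over E))) :
    IsLocallyConstant fun x : (quasiSplit F E c N).Adelic => borelHeight (x * finAdelicToAdelic F E c N ((StdForm.antidiagonal N).over E) g) / borelHeight x := by
  have h : (fun x : (quasiSplit F E c N).Adelic => borelHeight (x * finAdelicToAdelic F E c N ((StdForm.antidiagonal N).over E) g) / borelHeight x) =
      fun x => (∏ᶠ v, vecFinHeight E v (lastRow x)) / ∏ᶠ v, vecFinHeight E v (lastRow (x * finAdelicToAdelic F E c N ((StdForm.antidiagonal N).over E) g)) :=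
    funext fun x => borelHeight_mul_finAdelicToAdelic_div_eq x g
  rw [h]
  exact (isLocallyConstant_finprod_vecFinHeight_lastRow (F := F) (E := E) (c := c) (N := N)).comp₂
    ((isLocallyConstant_finprod_vecFinHeight_lastRow (F := F) (E := E) (c := c) (N := N)).comp_continuous (continuous_mul_const _)) (· / ·)

/-- **EVERY LEVEL SET `{x | H(x·ι_f g)∕H(x) = r}` IS CLOPEN** in `U(J_N)(𝔸_F)` (all `r : ℝ≥0`; in particular `𝟙[c_g = r] · φ(·ι_f g)` is continuous whenever `φ` is).
[cite: Garrett2018, §2.2 (PDF p. 82)] [cite: MoeglinWaldspurger1995, I.2.2] -/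
theorem isClopen_setOf_borelHeight_mul_finAdelicToAdelic_div_eq (g : ↥(finAdelic F E c N ((StdForm.antidiagonal N).over E))) (r : ℝ≥0) :
    IsClopen {x : (quasiSplit F E c N).Adelic | borelHeight (x * finAdelicToAdelic F E c N ((StdForm.antidiagonal N).over E) g) / borelHeight x = r} :=
  (isLocallyConstant_borelHeight_mul_finAdelicToAdelic_div g).isClopen_fiber r

/-- The height cocycle is continuous. [cite: MoeglinWaldspurger1995, I.2.2] -/
theorem continuous_borelHeight_mul_finAdelicToAdelic_div (g : ↥(finAdelic F E c N ((StdForm.antidiagonal N).over E))) :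
    Continuous fun x : (quasiSplit F E c N).Adelic => borelHeight (x * finAdelicToAdelic F E c N ((StdForm.antidiagonal N).over E) g) / borelHeight x :=
  (isLocallyConstant_borelHeight_mul_finAdelicToAdelic_div g).continuous

/-! ## §3 Left `B(𝔸_F)`-invariance -/

/-- **THE HEIGHT COCYCLE IS LEFT-`B(𝔸_F)`-INVARIANT**: `H(b x·ι_f g)∕H(b x) = H(x·ι_f g)∕H(x)` — `H(b y) = ‖b_NN‖_𝔸⁻¹ · H(y)` (★ `borelHeight_borel_mul`) for `y = x` and `y = x·ι_f g`, and the modulus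
`‖b_NN‖_𝔸⁻¹ ≠ 0` (heights are positive) cancels. [cite: Garrett2018, §2.2 (PDF p. 83)] [cite: MoeglinWaldspurger1995, I.2.2] -/
theorem borelHeight_borel_mul_mul_finAdelicToAdelic_div {b : (quasiSplit F E c N).Adelic} (hb : b ∈ borelAdelic F E c N) (x : (quasiSplit F E c N).Adelic)
    (g : ↥(finAdelic F E c N ((StdForm.antidiagonal N).over E))) :
    borelHeight (b * x * finAdelicToAdelic F E c N ((StdForm.antidiagonal N).over E) g) / borelHeight (b * x) =
      borelHeight (x * finAdelicToAdelic F E c N ((StdForm.antidiagonal N).over E) g) / borelHeight x := by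
  have hm : (IdeleClassGroup.ideleNorm E (lastEntryUnit hb))⁻¹ ≠ 0 := by
    intro h0
    have hpos := borelHeight_pos (b * x)
    rw [borelHeight_borel_mul hb, h0, zero_mul] at hpos
    exact lt_irrefl _ hpos
  rw [mul_assoc, borelHeight_borel_mul hb, borelHeight_borel_mul hb, mul_div_mul_left _ _ hm]

/-! ## §4 Finitely many values -/

/-- **FINITELY MANY VALUES, generic form (modulo the adelic Iwasawa decomposition `G(𝔸) = B(𝔸)·K_U`)**: by §3 the range of the cocycle is its image of `K_U = G(𝔸) ∩ K_∞·GL_N(𝒪̂_E)`, which is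
COMPACT (★ `isCompact_comap_adelicVal_standardMaximalCompactGL`), and a locally constant function (§2) has finite range on a compact space. [cite: Garrett2018, §2.2 (PDF p. 82)]
[cite: MoeglinWaldspurger1995, I.2.2] -/
theorem finite_range_borelHeight_mul_finAdelicToAdelic_div_of_iwasawa
    (hIw : ∀ x : (quasiSplit F E c N).Adelic, ∃ b ∈ borelAdelic F E c N, ∃ k : (quasiSplit F E c N).Adelic,
      adelicVal F E c N ((StdForm.antidiagonal N).over E) k ∈ standardMaximalCompactGL N E ∧ x = b * k)
    (g : ↥(finAdelic F E c N ((StdForm.antidiagonal N).over E))) :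
    (Set.range fun x : (quasiSplit F E c N).Adelic => borelHeight (x * finAdelicToAdelic F E c N ((StdForm.antidiagonal N).over E) g) / borelHeight x).Finite := by
  -- the compact `K_U` as a subtype
  set KU : Set (quasiSplit F E c N).Adelic :=
    (((standardMaximalCompactGL N E).comap (adelicVal F E c N ((StdForm.antidiagonal N).over E)) : Subgroup (quasiSplit F E c N).Adelic) : Set (quasiSplit F E c N).Adelic)
    with hKU
  have hKc : IsCompact KU := isCompact_comap_adelicVal_standardMaximalCompactGL
  haveI : CompactSpace KU := isCompact_iff_compactSpace.1 hKc
  -- the cocycle restricted to `K_U` is locally constant, hence has finite range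
  have hfin : (Set.range fun k : KU => borelHeight ((k : (quasiSplit F E c N).Adelic) * finAdelicToAdelic F E c N ((StdForm.antidiagonal N).over E) g) /
      borelHeight (k : (quasiSplit F E c N).Adelic)).Finite :=
    ((isLocallyConstant_borelHeight_mul_finAdelicToAdelic_div g).comp_continuous continuous_subtype_val).range_finite
  refine hfin.subset ?_
  rintro _ ⟨x, rfl⟩
  obtain ⟨b, hb, k, hk, rfl⟩ := hIw x
  refine ⟨⟨k, ?_⟩, ?_⟩
  · rw [hKU]; exact Subgroup.mem_comap.2 hk
  · exact (borelHeight_borel_mul_mul_finAdelicToAdelic_div hb k g).symm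

end Generic

/-! ## §4 (CM, `N = 3`) letter-free -/

section CM

variable (L : Type) [Field L] [NumberField L] [IsCMField L]

/-- **FINITELY MANY VALUES at CM `U(2,1)`** (letter-free: the adelic Iwasawa decomposition is ★ `exists_mem_borelAdelic_mul_mem_standardMaximalCompactGL_cm_three`): for every `g ∈ U(J₃)(𝔸_{L⁺,f})`
the height cocycle `x ↦ H(x·ι_f g)∕H(x)` on `U(J₃)(𝔸_{L⁺})` has finite range. [cite: Garrett2018, §2.2 (PDF p. 82)] [cite: MoeglinWaldspurger1995, I.2.2] -/
theorem finite_range_borelHeight_mul_finAdelicToAdelic_div_cm_three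
    (g : ↥(finAdelic (↥(maximalRealSubfield L)) L (IsCMField.complexConj L) 3 ((StdForm.antidiagonal 3).over L))) :
    (Set.range fun x : (quasiSplit (↥(maximalRealSubfield L)) L (IsCMField.complexConj L) 3).Adelic =>
      borelHeight (x * finAdelicToAdelic (↥(maximalRealSubfield L)) L (IsCMField.complexConj L) 3 ((StdForm.antidiagonal 3).over L) g) / borelHeight x).Finite :=
  finite_range_borelHeight_mul_finAdelicToAdelic_div_of_iwasawa (exists_mem_borelAdelic_mul_mem_standardMaximalCompactGL_cm_three L) g

/-- **THE DEALER'S SHAPE `∃ s : Finset ℝ≥0, ∀ x, H(x·ι_f g)∕H(x) ∈ s`** at CM `U(2,1)`, letter-free; with `isClopen_setOf_borelHeight_mul_finAdelicToAdelic_div_eq` (every fibre clopen) and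
`borelHeight_borel_mul_mul_finAdelicToAdelic_div` (left-`B(𝔸)`-invariance) this is the (T_f) re-expansion input of the `hTRANS` payer. [cite: Garrett2018, §2.2 (PDF p. 82)]
[cite: MoeglinWaldspurger1995, II.1] -/
theorem exists_finset_borelHeight_mul_finAdelicToAdelic_div_mem_cm_three
    (g : ↥(finAdelic (↥(maximalRealSubfield L)) L (IsCMField.complexConj L) 3 ((StdForm.antidiagonal 3).over L))) :
    ∃ s : Finset ℝ≥0, ∀ x : (quasiSplit (↥(maximalRealSubfield L)) L (IsCMField.complexConj L) 3).Adelic,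
      borelHeight (x * finAdelicToAdelic (↥(maximalRealSubfield L)) L (IsCMField.complexConj L) 3 ((StdForm.antidiagonal 3).over L) g) / borelHeight x ∈ s :=
  ⟨(finite_range_borelHeight_mul_finAdelicToAdelic_div_cm_three L g).toFinset, fun x => (Set.Finite.mem_toFinset _).2 ⟨x, rfl⟩⟩

end CM

end Summit.HodgeConjecture.HodgeConjecture.R90.S8

end
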